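import Summits.BirchSwinnertonDyer.BirchSwinnertonDyer.Theorems.UniversalToricDescentTorsionFreeByCount
import Summits.BirchSwinnertonDyer.BirchSwinnertonDyer.Theorems.UniversalToricDescentDualPairIdealCount
import Literature.NumberTheory.EllipticCurves.IwasawaDualFunctorialityProofs
import HarnessLib

/-!
# Dual-pair toolkit for the growth road (crux ♭T≤ stmt-BirchSwinnertonDyer-23042 `DefectTransportModThreePT`, line
# `sigmacongruence`, stub TS1′ `stub_twinStrictSurj`, assembly (1e))

Route `UniversalToricDescent`, lead prover `bsd-wall-utd-p1` g16. THEOREMS ONLY (no definition, no named fact, no `sorry`);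
`--supports stmt-BirchSwinnertonDyer-23042`. BSD is not proved by any of this.

Generic algebra around the tree's axiomatic Pontryagin duality `IwasawaDual.IsDualPair p ψ toDual` (a `Λ = ℤ_p⟦T⟧`-module
`X ≅ Hom(S, ℚ/ℤ)` with `T` acting as the transpose of `ψ`), used to run the growth ⟹ injectivity theorem
`injective_of_weakLeopoldt_growth` (p645087) on the dual of the signature map at the strict place:

* `isDualPair_id_of_isLocNil` — `(Hom(S, ℚ/ℤ), S, ψ, id)` with the module structure `IsLocNil.module` IS a dual pair;
* `isLocNil_one_add_pow_sub_one` — local nilpotence of `ψ` passes to `(1+ψ)^q − 1` (`= ψ · Σ_{i<q} (1+ψ)^i`);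
  `isLocNil_of_componentwise` — and to a componentwise endomorphism of `ι → H`, `ι` finite;
* `finite_quotient_span_pow_omega_smul_top` — for a finitely generated `Λ`-module `Q`, `Q ⧸ (p^k, ω_n)Q` is finite
  (`Q/ω_n Q` is finitely generated over `ℤ_p`, and `#(M/p^k M) = p^{ka} · #(T/p^kT) ≠ 0`); hence
  `finite_torsion_fixed_of_moduleFinite` — in a dual pair with `X` finitely generated the sets
  `{s | p^k s = 0, (1+ψ)^{p^n} s = s}` are finite (`natCard_quotient_span_pow_omega_smul`, p646050);
* `range_eq_ker_of_toDual_comp` — for `Θ : S_Y → S_P` intertwining `ψ_Y, ψ_P`, its transpose `F : X_P → X_Y` and the transpose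
  `R : X_Y → X″` of `ker Θ ↪ S_Y`: **`range F = ker R`** (a character of `S_Y` killing `ker Θ` factors through `S_Y / ker Θ ↪ S_P`
  and extends, `ℚ/ℤ` being injective — Mathlib `CharacterModule.dual_surjective_of_injective`);
* `surjective_of_injective_transpose` — if the transpose `F` of `Θ` is injective then `Θ` is onto (characters separate points).

References: [GreenbergLNM1716] §1 p. 60 (Pontryagin duals as `Λ`-modules); [Lang1990] Ch. 5 §1; [Washington1997] §13.2;
Bourbaki, *Algèbre* II §1 no. 9 (duality into an injective cogenerator is exact).
-/

-- the Theorems namespace of this sub repeats the summit name by design (D-0017 nested layout)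
set_option linter.dupNamespace false

noncomputable section

open scoped Classical

namespace Summit.BirchSwinnertonDyer.BirchSwinnertonDyer.Theorems.UniversalToricDescentTorsionFreeByCount

open Literature.NumberTheory.EllipticCurves Literature.NumberTheory.EllipticCurves.IwasawaDual
  Summit.BirchSwinnertonDyer.BirchSwinnertonDyer.Theorems.UniversalToricDescentDualPairIdealCount

universe u

variable (p : ℕ) [hp : Fact p.Prime]

/-! ## §1. `Hom(S, ℚ/ℤ)` with `IsLocNil.module` is a dual pair -/

/-- **`(Hom(S, ℚ/ℤ), S, ψ, id)` is a dual pair** for the `Λ`-structure `IsLocNil.module` of a locally nilpotent `(p, ψ)`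
(`T` acts as `x ↦ x ∘ ψ`, constants through `ℤ_p → ℤ/p^k`). [cite: GreenbergLNM1716, §1 p. 60 (after Conj. 1.3)] -/
theorem isDualPair_id_of_isLocNil {S : Type*} [AddCommGroup S] {ψ : AddMonoid.End S} (h : IsLocNil p ψ) :
    letI := h.module (A := AddCircle (1 : ℚ))
    IsDualPair p ψ (AddMonoidHom.id (S →+ AddCircle (1 : ℚ))) := by
  letI := h.module (A := AddCircle (1 : ℚ))
  exact
    { bijective := Function.bijective_id
      T_smul := fun x s => by
        change h.smulFun PowerSeries.X x s = x (ψ s)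
        exact h.smulFun_X_apply x s
      C_smul := fun c x s k hk => by
        change h.smulFun (PowerSeries.C c) x s = (PadicInt.toZModPow k c).val • x s
        exact h.smulFun_C_apply c x hk
      locNil := h }

/-! ## §2. Local nilpotence is inherited by `(1+ψ)^q − 1` and by products -/

/-- `(1 + ψ)^q − 1 = (Σ_{i<q} (1+ψ)^i) · ψ` and the two factors commute; hence `((1+ψ)^q − 1)^N = g^N ψ^N`. [folklore] -/
theorem one_add_pow_sub_one_pow_eq {S : Type*} [AddCommGroup S] (ψ : AddMonoid.End S) (q N : ℕ) :
    ((1 + ψ) ^ q - 1) ^ N =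
      ((Finset.range q).sum fun i => (1 + ψ) ^ i) ^ N * ψ ^ N := by
  have hgeom : ((Finset.range q).sum fun i => (1 + ψ) ^ i) * ψ = (1 + ψ) ^ q - 1 := by
    have := geom_sum_mul (1 + ψ) q
    rwa [add_sub_cancel_left] at this
  have hcomm : Commute ((Finset.range q).sum fun i => (1 + ψ) ^ i) ψ :=
    Commute.sum_left _ _ _ fun i _ => ((Commute.one_left ψ).add_left (Commute.refl ψ)).pow_left i
  rw [← hgeom, hcomm.mul_pow]

omit hp in
/-- **If `(p, ψ)` is locally nilpotent on `S`, so is `(p, (1+ψ)^q − 1)`** (e.g. `ψ = conj_γ − 1`,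
`(1+ψ)^{p^c} − 1 = conj_{γ^{p^c}} − 1`). [cite: GreenbergLNM1716, §1 p. 60] -/
theorem isLocNil_one_add_pow_sub_one {S : Type*} [AddCommGroup S] {ψ : AddMonoid.End S}
    (h : IsLocNil p ψ) (q : ℕ) : IsLocNil p ((1 + ψ) ^ q - 1) := by
  refine ⟨h.torsion, fun s => ?_⟩
  obtain ⟨N, hN⟩ := h.nil s
  refine ⟨N, ?_⟩
  rw [one_add_pow_sub_one_pow_eq, AddMonoid.End.coe_mul, Function.comp_apply, hN, map_zero]

/-- Powers of a componentwise endomorphism are componentwise powers. [folklore] -/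
theorem pow_apply_of_componentwise {ι H : Type*} [AddCommGroup H] (ψ : AddMonoid.End H)
    {Ψ : AddMonoid.End (ι → H)} (hΨ : ∀ (f : ι → H) (i : ι), Ψ f i = ψ (f i)) (N : ℕ) (f : ι → H) (i : ι) :
    (Ψ ^ N) f i = (ψ ^ N) (f i) := by
  induction N generalizing f with
  | zero => rfl
  | succ N ih =>
    rw [pow_succ, AddMonoid.End.coe_mul, Function.comp_apply, ih, pow_succ, AddMonoid.End.coe_mul,
      Function.comp_apply, hΨ]

omit hp in
/-- **Local nilpotence of a componentwise endomorphism** `Ψ` of `ι → H` (`ι` finite, `(Ψ f) i = ψ (f i)`) induced by a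
locally nilpotent `(p, ψ)` on `H`. [folklore] -/
theorem isLocNil_of_componentwise {ι H : Type*} [Finite ι] [AddCommGroup H] {ψ : AddMonoid.End H}
    (h : IsLocNil p ψ) {Ψ : AddMonoid.End (ι → H)} (hΨ : ∀ (f : ι → H) (i : ι), Ψ f i = ψ (f i)) :
    IsLocNil p Ψ := by
  haveI := Fintype.ofFinite ι
  refine ⟨fun f => ?_, fun f => ?_⟩
  · choose k hk using fun i => h.torsion (f i)
    refine ⟨Finset.univ.sum k, funext fun i => ?_⟩
    have hle : k i ≤ Finset.univ.sum k :=
      Finset.single_le_sum (f := k) (fun j _ => Nat.zero_le (k j)) (Finset.mem_univ i)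
    change (p ^ Finset.univ.sum k) • f i = 0
    rw [← Nat.sub_add_cancel hle, pow_add, mul_smul, hk, smul_zero]
  · choose N hN using fun i => h.nil (f i)
    refine ⟨Finset.univ.sum N, funext fun i => ?_⟩
    have hle : N i ≤ Finset.univ.sum N :=
      Finset.single_le_sum (f := N) (fun j _ => Nat.zero_le (N j)) (Finset.mem_univ i)
    rw [pow_apply_of_componentwise ψ hΨ, Pi.zero_apply, ← Nat.sub_add_cancel hle, pow_add, AddMonoid.End.coe_mul,
      Function.comp_apply, hN, map_zero]

/-! ## §3. Finiteness of `Q ⧸ (p^k, ω_n) Q` and of the fixed torsion sets -/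

/-- **`Q ⧸ (p^k, ω_n) Q` is finite for a finitely generated `Λ`-module `Q`** (`Q/ω_nQ ≅ ℤ_p^a ⊕ T` over `ℤ_p`,
`#((Q/ω_nQ)/p^k) = p^{ka} · #(T/p^kT) ≠ 0`). [cite: Washington1997, §13.2 (Lemma 13.7, Prop. 13.8)] -/
theorem finite_quotient_span_pow_omega_smul_top (Q : Type u) [AddCommGroup Q] [Module (IwasawaAlgebra p) Q]
    [Module.Finite (IwasawaAlgebra p) Q] (n k : ℕ) :
    Finite (Q ⧸ (Ideal.span {(p : IwasawaAlgebra p) ^ k, ((1 : IwasawaAlgebra p) + PowerSeries.X) ^ (p ^ n) - 1} •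
      ⊤ : Submodule (IwasawaAlgebra p) Q)) := by
  letI : Module ℤ_[p] Q := Module.compHom Q (algebraMap ℤ_[p] (IwasawaAlgebra p))
  haveI : IsScalarTower ℤ_[p] (IwasawaAlgebra p) Q := isScalarTower_compHom p Q
  haveI : Module.Finite ℤ_[p] (Q ⧸ (Ideal.span {((1 : IwasawaAlgebra p) + PowerSeries.X) ^ (p ^ n) - 1} •
      ⊤ : Submodule (IwasawaAlgebra p) Q)) := by
    have h := moduleFinite_int_quotient_smul_top p (Kato2004.IwasawaH1Exists.isDistinguishedAt_omega p n) Q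
    rwa [coe_omega] at h
  obtain ⟨a, T, _, _, _, ⟨e⟩⟩ := Literature.Algebra.Module.PadicInt.exists_linearEquiv_prod_finite p
    (Q ⧸ (Ideal.span {((1 : IwasawaAlgebra p) + PowerSeries.X) ^ (p ^ n) - 1} • ⊤ : Submodule (IwasawaAlgebra p) Q))
  apply Nat.finite_of_card_ne_zero
  rw [← natCard_quotient_quotient_eq, natCard_quotient_span_pow_smul_top_eq p e]
  haveI : Finite (T ⧸ (Ideal.span {(p : ℤ_[p]) ^ k} • ⊤ : Submodule ℤ_[p] T)) :=
    Finite.of_surjective _ (Submodule.mkQ_surjective _)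
  exact mul_ne_zero (pow_ne_zero _ hp.out.ne_zero) Nat.card_pos.ne'

/-- **In a dual pair with `X` finitely generated over `Λ`, the sets `{s | p^k s = 0, (1+ψ)^{p^n} s = s}` are finite**
(their character group is `X ⧸ (p^k, ω_n) X`, p646050). [cite: GreenbergLNM1716, §1 p. 60 (`X/𝔪X` finite ⟺ `S[𝔪]` finite)] -/
theorem finite_torsion_fixed_of_moduleFinite {S : Type*} [AddCommGroup S] {ψ : AddMonoid.End S}
    {X : Type u} [AddCommGroup X] [Module (PowerSeries ℤ_[p]) X] {toDual : X →+ (S →+ AddCircle (1 : ℚ))}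
    (h : IsDualPair p ψ toDual) [Module.Finite (PowerSeries ℤ_[p]) X] (n k : ℕ) :
    Finite ((DistribSMul.toAddMonoidHom S (p ^ k)).ker ⊓ ((1 + ψ) ^ (p ^ n) - 1).ker : AddSubgroup S) := by
  apply Nat.finite_of_card_ne_zero
  rw [← natCard_quotient_span_pow_omega_smul h n k, Nat.cast_pow]
  haveI := finite_quotient_span_pow_omega_smul_top p X n k
  exact Nat.card_pos.ne'

/-! ## §4. Transposes: `range Θ^∨ = ker (incl_{ker Θ})^∨`, and `Θ^∨` injective ⟹ `Θ` onto -/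

section Transpose

variable {SY : Type*} [AddCommGroup SY] {ψY : AddMonoid.End SY}
  {XY : Type*} [AddCommGroup XY] [Module (PowerSeries ℤ_[p]) XY] {toDualY : XY →+ (SY →+ AddCircle (1 : ℚ))}
  {SP : Type*} [AddCommGroup SP] {ψP : AddMonoid.End SP}
  {XP : Type*} [AddCommGroup XP] [Module (PowerSeries ℤ_[p]) XP] {toDualP : XP →+ (SP →+ AddCircle (1 : ℚ))}
  {X'' : Type*} [AddCommGroup X''] [Module (PowerSeries ℤ_[p]) X'']

/-- **`range Θ^∨ = ker (ker Θ ↪ S_Y)^∨`.** For `Θ : S_Y → S_P`, an additive `F : X_P → X_Y` with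
`toDual_Y (F x) = toDual_P x ∘ Θ` (the transpose) and an additive `R : X_Y → X″` with `toDual″ (R y) = toDual_Y y|_{ker Θ}`,
`toDual″` injective: `range F = ker R` — a character of `S_Y` vanishing on `ker Θ` factors through `S_Y / ker Θ ↪ S_P` and
extends to `S_P` because `ℚ/ℤ` is an injective `ℤ`-module. [cite: GreenbergLNM1716, §1 p. 60] -/
theorem range_eq_ker_of_toDual_comp (hY : IsDualPair p ψY toDualY) (hP : IsDualPair p ψP toDualP)
    (Θ : SY →+ SP) {toDual'' : X'' →+ (Θ.ker →+ AddCircle (1 : ℚ))} (h'' : Function.Injective toDual'')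
    (F : XP →ₗ[PowerSeries ℤ_[p]] XY) (hF : ∀ (x : XP) (s : SY), toDualY (F x) s = toDualP x (Θ s))
    (R : XY →ₗ[PowerSeries ℤ_[p]] X'') (hR : ∀ (y : XY) (s : Θ.ker), toDual'' (R y) s = toDualY y s) :
    LinearMap.range F = LinearMap.ker R := by
  apply le_antisymm
  · rintro _ ⟨x, rfl⟩
    rw [LinearMap.mem_ker]
    apply h''
    ext s
    rw [hR, hF, map_zero, AddMonoidHom.zero_apply, (AddMonoidHom.mem_ker).mp s.2, map_zero]
  · intro y hy
    rw [LinearMap.mem_ker] at hy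
    -- `χ = toDual_Y y` kills `ker Θ`
    have hχ : ∀ s ∈ Θ.ker, toDualY y s = 0 := fun s hs => by
      rw [← hR y ⟨s, hs⟩, hy, map_zero, AddMonoidHom.zero_apply]
    -- factor through `S_Y / ker Θ` and extend along the injection `S_Y / ker Θ → S_P`
    let χbar : SY ⧸ Θ.ker →+ AddCircle (1 : ℚ) := QuotientAddGroup.lift Θ.ker (toDualY y) hχ
    obtain ⟨χP, hχP⟩ := CharacterModule.dual_surjective_of_injective (R := ℤ)
      (QuotientAddGroup.kerLift Θ).toIntLinearMap (QuotientAddGroup.kerLift_injective Θ) χbar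
    obtain ⟨x, hx⟩ := hP.bijective.2 χP
    refine ⟨x, hY.bijective.1 ?_⟩
    ext s
    rw [hF, hx]
    have h1 := congrArg (fun c : CharacterModule (SY ⧸ Θ.ker) => c (QuotientAddGroup.mk s)) hχP
    simp only [CharacterModule.dual_apply, χbar] at h1
    exact h1

/-- **If the transpose `F` of `Θ` is injective then `Θ` is onto**: a non-zero character of `S_P / Θ(S_Y)` (characters separate
points, Mathlib `CharacterModule.exists_character_apply_ne_zero_of_ne_zero`) would be a non-zero `x ∈ X_P` with `F x = 0`.
[cite: GreenbergLNM1716, §1 p. 60] -/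
theorem surjective_of_injective_transpose (hY : IsDualPair p ψY toDualY) (hP : IsDualPair p ψP toDualP)
    (Θ : SY →+ SP) (F : XP →ₗ[PowerSeries ℤ_[p]] XY) (hF : ∀ (x : XP) (s : SY), toDualY (F x) s = toDualP x (Θ s))
    (hinj : Function.Injective F) : Function.Surjective Θ := by
  intro t
  by_contra ht
  have hne : (QuotientAddGroup.mk t : SP ⧸ Θ.range) ≠ 0 := by
    intro h0
    rw [QuotientAddGroup.eq_zero_iff] at h0
    obtain ⟨s, hs⟩ := h0
    exact ht ⟨s, hs⟩
  obtain ⟨χ, hχt⟩ := CharacterModule.exists_character_apply_ne_zero_of_ne_zero hne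
  let χ' : SP →+ AddCircle (1 : ℚ) := χ.comp (QuotientAddGroup.mk' Θ.range)
  have hχ' : ∀ u : SP, χ' u = χ (QuotientAddGroup.mk u) := fun u => rfl
  obtain ⟨x, hx⟩ := hP.bijective.2 χ'
  have hFx : F x = 0 := by
    apply hY.bijective.1
    ext s
    rw [hF, hx, map_zero, AddMonoidHom.zero_apply, hχ',
      (QuotientAddGroup.eq_zero_iff _).mpr (AddMonoidHom.mem_range.mpr ⟨s, rfl⟩), map_zero]
  have hx0 : x = 0 := hinj (by rw [hFx, map_zero])
  apply hχt
  rw [← hχ', ← hx, hx0, map_zero, AddMonoidHom.zero_apply]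

end Transpose

end Summit.BirchSwinnertonDyer.BirchSwinnertonDyer.Theorems.UniversalToricDescentTorsionFreeByCount

end
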